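import Summits.Ventures.Crystal3D.Theorems.StickyWulffConstantTextureLiminfTexShadowBilayerFrameRigidity
import Summits.Ventures.Crystal3D.Theorems.StickyWulffConstantTextureLiminfTexShadowInnerFaceCount
import Summits.Ventures.Crystal3D.Theorems.StickyWulffConstantTextureLiminfTexShadowCoaxialCharge
import Summits.Ventures.Crystal3D.Theorems.StickyWulffConstantTextureLiminfTexShadowZeroTable
import HarnessLib

/-!
# TexShadow — the PER-PAIR closers for `BothFcc` plate pairs of the (α) kind: co-axial DISTINCT affine plates from lane F's
# cell matrix, EQUAL linear lattices from the zero table (lane T, crux `TextureLiminf`, stmt-Ventures-19483; line `TexShadow`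
# v6.17 → v6.18, cf-p1 DECISION (xlv⁗): «fam*Fcc DERIVED from {F-U, G-U, zero cell, currency glue}»)

HONEST FRAMING. Venture `Summits/Ventures/Crystal3D` (cell `crystal3d-full`), helper `--supports` the crux `TextureLiminf`
(stmt-Ventures-19483) of `route-Ventures-StickyWulffConstant`, registered line `TexShadow`.  Rung credit only; F-C1 not moved.
Pure proofs, standard axioms, no new definitions.  Lane F's uniform sibling `CoaxialTwoSlabAdhesionUnifFrom` (debt F-U,
19481-p2) is NOT assumed by name here: this file discharges everything BETWEEN one instance of F's cell matrix (for one affine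
pair, at explicit `(C, R₀)`, frame data `L`) and T's `BilayerWallAt` for the presented pair — so that the v6.18 closer is the
quantifier plumbing `∀ R₀ ≥ R, ∃ C, ∀ pairs` around these lemmas and nothing else.

For a `BothFcc` pair presented as `(Lₖ, sₖ, σₖ)` with affine lattices `stacking Lₖ sₖ σₖ = (Pₖ· + sₖ) '' Λ₀`
(`exists_affine_fcc_pair_of_bothFcc`), bilayer frames `BilayerFramesAt Lₖ sₖ σₖ Aₖ uₖ` and an admissible table `c`:
* `tsum_charge_le_of_frameData` — F's shared-frame data for the affine pair (`(Pₖ·+sₖ) '' Λ₀ ⊆ (L·+rₖ) '' Barlow`) caps the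
  table's charge of the unit slice by `½·√(1−⟪Le₃,e₃⟫²)·πρ²` (bilayer-frame rigidity `frames_equal_or_coaxial_of_sharedAxis`
  + glue (b) `tsum_charge_le_half_sin`);
* **`bilayerWallAt_of_coaxialCell`** — F's cell matrix for the affine pair at `(C, R₀)` with frame `L` (VERBATIM the matrix of
  `CoaxialTwoSlabAdhesion`) ⇒ `BilayerWallAt (C + 60√2π) R₀ σ₁ σ₂ L₁ L₂ s₁ s₂ c` (via glue (a) `bilayerWallAt_of_adhesionAt`);
* **`bilayerWallAt_of_equal_linear`** — if the two plates have the SAME linear lattice `P₁ '' fccRef = P₂ '' fccRef` (translates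
  included), every admissible table vanishes and the zero table pays: `BilayerWallAt ((3456 + 1152(R₀+1))/2) R₀ …` (`R₀ ≥ 3`);
* `affine_coax_of_coAx` — T's linear `CoAx P₁ P₂` gives F's affine co-axiality hypothesis for `(P₁, s₁, P₂, s₂)`;
* `affine_ne_of_linear_ne` — distinct linear lattices ⇒ distinct affine plates (F's distinctness hypothesis).
So for an (α) pair: `by_cases P₁ '' fccRef = P₂ '' fccRef` — zero cell, else F-U's instance + `bilayerWallAt_of_coaxialCell`.
WHAT THIS IS NOT: not the (β) non-co-axial branch (lane G's uniform priced-class sibling G-U), not the `∀ R₀ ≥ R, ∃ C` plumbing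
(waits for F-U's def by name); F-C1 not moved.
-/

noncomputable section

open scoped BigOperators InnerProductSpace ENNReal
open MeasureTheory

namespace Summit.Ventures.Crystal3D.Theorems

open Summit.Ventures.Crystal3D
open Summit.Ventures.Crystal3D.TentCertificate (image_fccRef_eq_of_bilayer_subset bilayer_subset_stacking)
open Literature.MathematicalPhysics.StatisticalMechanics (fccStacking barlowStacking IsHaggSeq contactDeficiency)
open Summit.Ventures.Crystal3D.Cruxes.TextureLiminf.TexShadow (E3 e₃ fccRef stacking bilayer laySlab SharedAxis CoAx
  BilayerFramesAt BilayerChargeAdmissible BilayerWallAt)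

/-- **F's frame data cap the table.**  If the affine plates `(Pₖ· + sₖ) '' Λ₀` of a `BothFcc` pair are registered in ONE moved
Barlow frame `L` (lane F's shared-frame data), then every admissible table on the pair's bilayer frames charges the unit slice of
radius `ρ` at most `½·√(1 − ⟪Le₃, e₃⟫²)·πρ²`. -/
theorem tsum_charge_le_of_frameData {σ₁ σ₂ : ℤ → ℤ} (hσ₁ : IsHaggSeq σ₁) (hσ₂ : IsHaggSeq σ₂)
    {L₁ L₂ P₁ P₂ : E3 ≃ₗᵢ[ℝ] E3} {s₁ s₂ : E3}
    (hS₁ : stacking L₁ s₁ σ₁ = (fun q => P₁ q + s₁) '' fccStacking 1 (Real.sqrt (2 / 3)))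
    (hS₂ : stacking L₂ s₂ σ₂ = (fun q => P₂ q + s₂) '' fccStacking 1 (Real.sqrt (2 / 3)))
    {A₁ A₂ : ℤ → (E3 ≃ₗᵢ[ℝ] E3)} {u₁ u₂ : ℤ → E3}
    (hfr₁ : BilayerFramesAt L₁ s₁ σ₁ A₁ u₁) (hfr₂ : BilayerFramesAt L₂ s₂ σ₂ A₂ u₂)
    {c : ℤ → ℤ → ℝ} {m : ℤ → ℤ → E3} (hadm : BilayerChargeAdmissible A₁ A₂ c m)
    {L : E3 ≃ₗᵢ[ℝ] E3} {r₁ r₂ : E3} {τ τ' : ℤ → ℤ} (hτ : IsHaggSeq τ) (hτ' : IsHaggSeq τ')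
    (h₁ : (fun q => P₁ q + s₁) '' fccStacking 1 (Real.sqrt (2 / 3)) ⊆
      (fun q => L q + r₁) '' barlowStacking 1 (Real.sqrt (2 / 3)) τ)
    (h₂ : (fun q => P₂ q + s₂) '' fccStacking 1 (Real.sqrt (2 / 3)) ⊆
      (fun q => L q + r₂) '' barlowStacking 1 (Real.sqrt (2 / 3)) τ')
    {ρ : ℝ} (hρ : 0 ≤ ρ) :
    ∑' ij : ℤ × ℤ, c ij.1 ij.2 * (volume (wallSlice ρ ∩ laySlab L₁ s₁ ij.1 ∩ laySlab L₂ s₂ ij.2)).toReal ≤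
      1 / 2 * Real.sqrt (1 - ⟪L (EuclideanSpace.single (2 : Fin 3) (1 : ℝ)),
        EuclideanSpace.single (2 : Fin 3) (1 : ℝ)⟫_ℝ ^ 2) * (Real.pi * ρ ^ 2) := by
  have hm : SharedAxis (L e₃) P₁ P₂ :=
    ⟨L, r₁ - s₁, r₂ - s₂, τ, τ', hτ, hτ', rfl, (image_fccRef_subset_barlow_iff_affine P₁ L s₁ r₁ τ).1 h₁,
      (image_fccRef_subset_barlow_iff_affine P₂ L s₂ r₂ τ').1 h₂⟩
  exact tsum_charge_le_half_sin L₁ L₂ s₁ s₂ hadm (Real.sqrt_nonneg _)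
    (frames_equal_or_coaxial_of_sharedAxis hσ₁ hσ₂ hS₁ hS₂ hfr₁ hfr₂ hm) hρ

/-- **The co-axial (α) cell, per pair.**  For a `BothFcc` pair with affine plate lattices `(Pₖ· + sₖ) '' Λ₀`, bilayer frames and an
admissible table: lane F's cell MATRIX for the affine pair `(P₁, s₁, P₂, s₂)` at explicit `(C, R₀)` with shared frame `L`
(verbatim the matrix of `CoaxialTwoSlabAdhesion`, charge `½√(1−⟪Le₃,e₃⟫²)`) gives T's cell inequality
`BilayerWallAt (C + 60√2π) R₀ σ₁ σ₂ L₁ L₂ s₁ s₂ c`. -/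
theorem bilayerWallAt_of_coaxialCell {σ₁ σ₂ : ℤ → ℤ} (hσ₁ : IsHaggSeq σ₁) (hσ₂ : IsHaggSeq σ₂)
    {L₁ L₂ P₁ P₂ : E3 ≃ₗᵢ[ℝ] E3} {s₁ s₂ : E3}
    (hS₁ : stacking L₁ s₁ σ₁ = (fun q => P₁ q + s₁) '' fccStacking 1 (Real.sqrt (2 / 3)))
    (hS₂ : stacking L₂ s₂ σ₂ = (fun q => P₂ q + s₂) '' fccStacking 1 (Real.sqrt (2 / 3)))
    {A₁ A₂ : ℤ → (E3 ≃ₗᵢ[ℝ] E3)} {u₁ u₂ : ℤ → E3}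
    (hfr₁ : BilayerFramesAt L₁ s₁ σ₁ A₁ u₁) (hfr₂ : BilayerFramesAt L₂ s₂ σ₂ A₂ u₂)
    {c : ℤ → ℤ → ℝ} {m : ℤ → ℤ → E3} (hadm : BilayerChargeAdmissible A₁ A₂ c m)
    {L : E3 ≃ₗᵢ[ℝ] E3} {r₁ r₂ : E3} {τ τ' : ℤ → ℤ} (hτ : IsHaggSeq τ) (hτ' : IsHaggSeq τ')
    (h₁ : (fun q => P₁ q + s₁) '' fccStacking 1 (Real.sqrt (2 / 3)) ⊆
      (fun q => L q + r₁) '' barlowStacking 1 (Real.sqrt (2 / 3)) τ)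
    (h₂ : (fun q => P₂ q + s₂) '' fccStacking 1 (Real.sqrt (2 / 3)) ⊆
      (fun q => L q + r₂) '' barlowStacking 1 (Real.sqrt (2 / 3)) τ')
    {C R₀ : ℝ} (hR₀ : 1 ≤ R₀)
    (hcell : ∀ h : ℝ, 0 ≤ h → ∀ ρ : ℝ, R₀ ≤ ρ → ∀ X Q₁ Q₂ : Finset E3,
      (∀ p ∈ X, ∀ q ∈ X, p ≠ q → 1 ≤ dist p q) → Q₁ ⊆ X → Q₂ ⊆ X \ Q₁ →
      (∀ p ∈ X, -(2 * R₀) ≤ p 2 ∧ p 2 ≤ h + 2 * R₀ ∧ p 0 ^ 2 + p 1 ^ 2 ≤ ρ ^ 2) →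
      (∀ p, p ∈ Q₁ ↔ (p ∈ (fun q => P₁ q + s₁) '' fccStacking 1 (Real.sqrt (2 / 3)) ∧
        -(2 * R₀) ≤ p 2 ∧ p 2 ≤ -R₀ ∧ p 0 ^ 2 + p 1 ^ 2 ≤ ρ ^ 2)) →
      (∀ p, p ∈ Q₂ ↔ (p ∈ (fun q => P₂ q + s₂) '' fccStacking 1 (Real.sqrt (2 / 3)) ∧
        h + R₀ ≤ p 2 ∧ p 2 ≤ h + 2 * R₀ ∧ p 0 ^ 2 + p 1 ^ 2 ≤ ρ ^ 2)) →
      ((((Q₁ ×ˢ (X \ Q₁)).filter fun pq => dist pq.1 pq.2 = 1).card : ℕ) : ℝ) +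
        ((((Q₂ ×ˢ ((X \ Q₁) \ Q₂)).filter fun pq => dist pq.1 pq.2 = 1).card : ℕ) : ℝ) ≤
        contactDeficiency ((X \ Q₁) \ Q₂) +
          (Real.sqrt 2 / 4 * ∑ᶠ w ∈ {w ∈ fccStacking 1 (Real.sqrt (2 / 3)) | ‖w‖ = 1},
              |⟪w, P₁.symm (EuclideanSpace.single (2 : Fin 3) (1 : ℝ))⟫_ℝ| +
            Real.sqrt 2 / 4 * ∑ᶠ w ∈ {w ∈ fccStacking 1 (Real.sqrt (2 / 3)) | ‖w‖ = 1},
              |⟪w, P₂.symm (EuclideanSpace.single (2 : Fin 3) (1 : ℝ))⟫_ℝ| -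
            (1 / 2 : ℝ) * Real.sqrt (1 - ⟪L (EuclideanSpace.single (2 : Fin 3) (1 : ℝ)),
              (EuclideanSpace.single (2 : Fin 3) (1 : ℝ))⟫_ℝ ^ 2)) * Real.pi * ρ ^ 2 +
          C * (1 + h) * ρ) :
    BilayerWallAt (C + 60 * Real.sqrt 2 * Real.pi) R₀ σ₁ σ₂ L₁ L₂ s₁ s₂ c :=
  bilayerWallAt_of_adhesionAt hS₁ hS₂ hR₀
    (fun ρ hρ => tsum_charge_le_of_frameData hσ₁ hσ₂ hS₁ hS₂ hfr₁ hfr₂ hadm hτ hτ' h₁ h₂ (by linarith))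
    hcell

/-- **The zero cell, per pair.**  If the two `BothFcc` plates have the SAME linear lattice (`P₁ '' fccRef = P₂ '' fccRef`;
relative translates allowed), every pair of bilayer frames has equal lattices (bilayer-frame rigidity), so every admissible table
vanishes and the zero table pays (`bilayerWallAt_of_equal_lattices`, `R₀ ≥ 3`). -/
theorem bilayerWallAt_of_equal_linear {σ₁ σ₂ : ℤ → ℤ} (hσ₁ : IsHaggSeq σ₁) (hσ₂ : IsHaggSeq σ₂)
    {L₁ L₂ P₁ P₂ : E3 ≃ₗᵢ[ℝ] E3} {s₁ s₂ : E3}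
    (hS₁ : stacking L₁ s₁ σ₁ = (fun q => P₁ q + s₁) '' fccStacking 1 (Real.sqrt (2 / 3)))
    (hS₂ : stacking L₂ s₂ σ₂ = (fun q => P₂ q + s₂) '' fccStacking 1 (Real.sqrt (2 / 3)))
    {A₁ A₂ : ℤ → (E3 ≃ₗᵢ[ℝ] E3)} {u₁ u₂ : ℤ → E3}
    (hfr₁ : BilayerFramesAt L₁ s₁ σ₁ A₁ u₁) (hfr₂ : BilayerFramesAt L₂ s₂ σ₂ A₂ u₂)
    {c : ℤ → ℤ → ℝ} {m : ℤ → ℤ → E3} (hadm : BilayerChargeAdmissible A₁ A₂ c m)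
    (heq : P₁ '' fccRef = P₂ '' fccRef) (R₀ : ℝ) (hR₀ : 3 ≤ R₀) :
    BilayerWallAt ((3456 + 1152 * (R₀ + 1)) / 2) R₀ σ₁ σ₂ L₁ L₂ s₁ s₂ c :=
  bilayerWallAt_of_equal_lattices hσ₁ hσ₂ L₁ L₂ s₁ s₂ R₀ hR₀ hadm fun i j => by
    rw [bilayerFrame_image_eq hσ₁ hS₁ hfr₁ i, bilayerFrame_image_eq hσ₂ hS₂ hfr₂ j, heq]

/-- **T's linear co-axiality gives F's affine co-axiality hypothesis** for the affine pair `(P₁, s₁, P₂, s₂)`. -/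
theorem affine_coax_of_coAx {P₁ P₂ : E3 ≃ₗᵢ[ℝ] E3} (s₁ s₂ : E3) (h : CoAx P₁ P₂) :
    ∃ (L : E3 ≃ₗᵢ[ℝ] E3) (r₁ r₂ : E3) (σ σ' : ℤ → ℤ), IsHaggSeq σ ∧ IsHaggSeq σ' ∧
      (fun p => P₁ p + s₁) '' fccStacking 1 (Real.sqrt (2 / 3)) ⊆
        (fun p => L p + r₁) '' barlowStacking 1 (Real.sqrt (2 / 3)) σ ∧
      (fun p => P₂ p + s₂) '' fccStacking 1 (Real.sqrt (2 / 3)) ⊆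
        (fun p => L p + r₂) '' barlowStacking 1 (Real.sqrt (2 / 3)) σ' := by
  obtain ⟨m, L, r₁, r₂, σ, σ', hσ, hσ', -, h₁, h₂⟩ := h
  refine ⟨L, r₁ + s₁, r₂ + s₂, σ, σ', hσ, hσ', ?_, ?_⟩
  · rw [image_fccRef_subset_barlow_iff_affine, add_sub_cancel_right]; exact h₁
  · rw [image_fccRef_subset_barlow_iff_affine, add_sub_cancel_right]; exact h₂

/-- **Distinct linear lattices give distinct affine plates** (F's distinctness hypothesis): if `stacking L₁ s₁ σ₁ = (P₁· + s₁) '' Λ₀`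
and `P₁ '' fccRef ≠ P₂ '' fccRef`, then `(P₁· + s₁) '' Λ₀ ≠ (P₂· + s₂) '' Λ₀` (a common bilayer would force equal linear
lattices, by bilayer-frame rigidity). -/
theorem affine_ne_of_linear_ne {σ₁ : ℤ → ℤ} (hσ₁ : IsHaggSeq σ₁) {L₁ P₁ P₂ : E3 ≃ₗᵢ[ℝ] E3} {s₁ s₂ : E3}
    (hS₁ : stacking L₁ s₁ σ₁ = (fun q => P₁ q + s₁) '' fccStacking 1 (Real.sqrt (2 / 3)))
    (hne : P₁ '' fccRef ≠ P₂ '' fccRef) :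
    (fun p => P₁ p + s₁) '' fccStacking 1 (Real.sqrt (2 / 3)) ≠
      (fun p => P₂ p + s₂) '' fccStacking 1 (Real.sqrt (2 / 3)) := by
  intro h
  apply hne
  have hb : bilayer L₁ s₁ σ₁ 0 ⊆ (fun p => P₁ p + s₁) '' fccRef := fun y hy => by
    have hy' := bilayer_subset_stacking L₁ s₁ σ₁ 0 hy; rw [hS₁] at hy'; exact hy'
  have hb' : bilayer L₁ s₁ σ₁ 0 ⊆ (fun p => P₂ p + s₂) '' fccRef := fun y hy => by
    have hy' := hb hy
    have h' : (fun p => P₁ p + s₁) '' fccRef = (fun p => P₂ p + s₂) '' fccRef := h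
    rw [h'] at hy'; exact hy'
  exact image_fccRef_eq_of_bilayer_subset hσ₁ L₁ s₁ 0 hb hb'

end Summit.Ventures.Crystal3D.Theorems

end
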